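import Summits.ResolutionOfSingularities.ResolutionOfSingularities.Theorems.HilbertSamuelEliminationSigmaMaxModificationsCorridor3WLadderMovingAltDefs
import Summits.ResolutionOfSingularities.ResolutionOfSingularities.Theorems.HilbertSamuelEliminationSigmaMaxModificationsCorridor3WLadderMovingIso
import Summits.ResolutionOfSingularities.ResolutionOfSingularities.Theorems.HilbertSamuelEliminationSigmaMaxModificationsCorridor3WLadderIsoTailExtraction
import HarnessLib

/-!
# [OURS · L1 W4.2] MODULE `Corridor3WLadderMovingAlt` (crux chain w42) — part 2/2: the TRICHOTOMY COVER (PROVED)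

DEAL D16 (res-L1-w42-plan-1 RULINGS v3.12-4 (V) → res-type-012).  Pure logic over the rows of part 1/2 (`…MovingAltDefs`) and r4
(`…MovingIsoDefs` p500943 / `…MovingIso` p501384): every moving chain is EVENTUALLY in `B`, EVENTUALLY outside `B`, or ALTERNATES infinitely
often (`eventually_not_or_io` twice) — `noMovingNearChainFrom_iff_trichotomy`; at row level with `B = Iso 3` and grade `ē ≥ 3`:
`atQ_of_trichotomy : WtopEvIsoM p Q → WtopEvNonIsoM p Q → WtopAltM p Q → (the grade-≥3 moving row at Q)`, its exactness `alt_pieces_of_atQ`,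
the registered pointed stub `wtop3PointedM_of_trichotomy`, and — with the isolated KERNEL and D7's DISCHARGED
extraction (`isoTailTowerExtractionM_holds`, res-D-pv-042 p513521/p514284) by name — THE POINTED STUB'S CLOSER SHAPE OF RECORD
`wtop3PointedM_of_kernel (hT : IsoQuadraticTowerTerminates p 3) (hev : WtopEvNonIsoM p QPointed) (halt : WtopAltM p QPointed) : Wtop3PointedM p`.
NO non-pointed twin is recorded: by res-L1-w42-plan-1 RULINGS v3.13-5 (k21 VERDICT CONFIRMED, 2026-08-27T09:16Z) the row
`WtopEvNonIsoM p QNonpointed` is FROZEN (stub-false AS TYPED for the CJS label strategy), so the non-pointed specialisation would only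
advertise a dead route — the cover stays available for EVERY origin predicate `Q` through `atQ_of_trichotomy` (e.g. a σ-guarded `Q` of v8).
Comparison lemmas: ALT is implied by either recurrent row of r4 (`wtopAltM_of_wtopRecIsoM`, `_of_wtopRecNonIsoM`),
so cover A / cover B refine to the trichotomy.  Everything PROVED; the open content is in the rows (kernel = C4/C5, Ev-NonIso = card H / D1 / D6 /
D9 / D13, ALT = D17).  OURS; NOT statements of print or of the manuscript; AI typing, weaker than expert review.
-/

set_option linter.dupNamespace false

open CategoryTheory AlgebraicGeometry TopologicalSpace
open Summit.ResolutionOfSingularities.ResolutionOfSingularities.Theorems.CampaignW42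
open Literature.AlgebraicGeometry.Resolution Literature.RingTheory.HilbertSamuel
open Literature.AlgebraicGeometry.CossartJannsenSaito2020
open Summit.ResolutionOfSingularities.ResolutionOfSingularities.Theses.HilbertSamuelElimination
open Summit.ResolutionOfSingularities.ResolutionOfSingularities.Theorems.SigmaMaxModificationsCorridor3
open Summit.ResolutionOfSingularities.ResolutionOfSingularities.Theorems.SigmaMaxModificationsCorridor3.Moving
open Summit.ResolutionOfSingularities.ResolutionOfSingularities.Theorems.SigmaMaxModificationsCorridor3.Helpers (QPointed)

namespace Summit.ResolutionOfSingularities.ResolutionOfSingularities.Cruxes.SigmaMaxModifications.IdeasL1Idea2R4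

universe u

variable {R : ∀ S : Scheme.{u}, CentreSeq S → Prop} {N : ℕ} {ν : ℕ → ℕ}

/-! ## §1. The trichotomy of a moving chain with respect to a stage predicate `B` -/

/-- **THE TRICHOTOMY SPLIT for moving chains (proved)**: no moving `G`-chain from `s₀` ⟺ none eventually inside `B`, none eventually outside
`B`, and none alternating — every chain's `B`-pattern is eventually constant or alternates (`eventually_not_or_io` twice; tails of chains from a
reached stage are chains from a reached stage, `reaches_chain` / `io_shift`). [folklore] -/
theorem noMovingNearChainFrom_iff_trichotomy {s₀ : MarkedStage.{u}} {G : MarkedStage.{u} → Prop} (B : MarkedStage.{u} → Prop) :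
    NoMovingNearChainFrom R N ν s₀ G ↔
      (NoMovingNearChainFrom R N ν s₀ fun s => G s ∧ B s) ∧ (NoMovingNearChainFrom R N ν s₀ fun s => G s ∧ ¬ B s) ∧
        NoMovingAlternatingNearChainFrom R N ν s₀ G B := by
  constructor
  · intro h
    refine ⟨?_, ?_, ?_⟩
    · rintro ⟨c, h0, hstep, hG, hmov⟩
      exact h ⟨c, h0, hstep, fun n => (hG n).1, hmov⟩
    · rintro ⟨c, h0, hstep, hG, hmov⟩
      exact h ⟨c, h0, hstep, fun n => (hG n).1, hmov⟩
    · rintro ⟨c, h0, hstep, hG, hmov, -, -⟩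
      exact h ⟨c, h0, hstep, hG, hmov⟩
  · rintro ⟨hin, hout, halt⟩ ⟨c, h0, hstep, hG, hmov⟩
    rcases eventually_not_or_io (fun n => B (c n)) with ⟨n₀, hn₀⟩ | hioB
    · -- eventually outside `B`: the tail from `n₀` is a `G ∧ ¬ B` chain
      exact hout ⟨fun n => c (n₀ + n), reaches_chain h0 hstep n₀, fun n => hstep (n₀ + n),
        fun n => ⟨hG _, hn₀ _ (Nat.le_add_right _ _)⟩, io_shift hmov n₀⟩
    · rcases eventually_not_or_io (fun n => ¬ B (c n)) with ⟨n₀, hn₀⟩ | hioN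
      · -- eventually inside `B`: the tail from `n₀` is a `G ∧ B` chain
        exact hin ⟨fun n => c (n₀ + n), reaches_chain h0 hstep n₀, fun n => hstep (n₀ + n),
          fun n => ⟨hG _, Classical.not_not.1 (hn₀ _ (Nat.le_add_right _ _))⟩, io_shift hmov n₀⟩
      · -- `B` and `¬ B` both infinitely often: alternating
        exact halt ⟨c, h0, hstep, hG, hmov, hioB, hioN⟩

/-- An alternating chain is in particular `B`-recurrent: the recurrent functional implies the alternating one. [folklore] -/
theorem noMovingAlternatingNearChainFrom_of_recurrent {s₀ : MarkedStage.{u}} {G B : MarkedStage.{u} → Prop}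
    (h : NoMovingRecurrentNearChainFrom R N ν s₀ G B) : NoMovingAlternatingNearChainFrom R N ν s₀ G B :=
  fun ⟨c, h0, hstep, hG, hmov, hio, _⟩ => h ⟨c, h0, hstep, hG, hmov, hio⟩

/-- … and `¬ B`-recurrent. [folklore] -/
theorem noMovingAlternatingNearChainFrom_of_recurrent_not {s₀ : MarkedStage.{u}} {G B : MarkedStage.{u} → Prop}
    (h : NoMovingRecurrentNearChainFrom R N ν s₀ G fun s => ¬ B s) : NoMovingAlternatingNearChainFrom R N ν s₀ G B :=
  fun ⟨c, h0, hstep, hG, hmov, _, hio⟩ => h ⟨c, h0, hstep, hG, hmov, hio⟩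

/-! ## §2. Row level at `B = Iso 3`, grade `ē ≥ 3`: Ev-Iso ∧ Ev-NonIso ∧ ALT ⟺ the W-top moving row at `Q` -/

/-- **Trichotomy cover (proved):** Ev-Iso ∧ Ev-NonIso ∧ ALT ⇒ the grade-`≥ 3` moving row at `Q`-origins. [folklore] -/
theorem atQ_of_trichotomy {p : ℕ} {Q : ℕ → (ℕ → ℕ) → ∀ X : Scheme.{u}, X → Prop}
    (hev : WtopEvIsoM p Q) (hnon : WtopEvNonIsoM p Q) (halt : WtopAltM p Q) :
    MaxOriginNoMovingNearChainAtQ.{u} p 3 Q fun s => 3 ≤ s.geomDirDim :=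
  fun R hRf hRa ν X _ x hX hQ =>
    (noMovingNearChainFrom_iff_trichotomy (fun s => Iso 3 s)).2
      ⟨hev R hRf hRa ν X x hX hQ, hnon R hRf hRa ν X x hX hQ, halt R hRf hRa ν X x hX hQ⟩

/-- **The cover is exact (proved):** the row gives back Ev-Iso, Ev-NonIso and ALT. [folklore] -/
theorem alt_pieces_of_atQ {p : ℕ} {Q : ℕ → (ℕ → ℕ) → ∀ X : Scheme.{u}, X → Prop}
    (h : MaxOriginNoMovingNearChainAtQ.{u} p 3 Q fun s => 3 ≤ s.geomDirDim) :
    WtopEvIsoM p Q ∧ WtopEvNonIsoM p Q ∧ WtopAltM p Q := by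
  refine ⟨fun R hRf hRa ν X _ x hX hQ => ?_, fun R hRf hRa ν X _ x hX hQ => ?_, fun R hRf hRa ν X _ x hX hQ => ?_⟩
  · exact ((noMovingNearChainFrom_iff_trichotomy (fun s => Iso 3 s)).1 (h R hRf hRa ν X x hX hQ)).1
  · exact ((noMovingNearChainFrom_iff_trichotomy (fun s => Iso 3 s)).1 (h R hRf hRa ν X x hX hQ)).2.1
  · exact ((noMovingNearChainFrom_iff_trichotomy (fun s => Iso 3 s)).1 (h R hRf hRa ν X x hX hQ)).2.2

/-- ALT is implied by r4's Rec-Iso row (an alternating chain is isolated infinitely often). [folklore] -/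
theorem wtopAltM_of_wtopRecIsoM {p : ℕ} {Q : ℕ → (ℕ → ℕ) → ∀ X : Scheme.{u}, X → Prop} (h : WtopRecIsoM.{u} p Q) :
    WtopAltM.{u} p Q :=
  fun R hRf hRa ν X _ x hX hQ => noMovingAlternatingNearChainFrom_of_recurrent (h R hRf hRa ν X x hX hQ)

/-- ALT is implied by r4's Rec-NonIso row (an alternating chain is non-isolated infinitely often). [folklore] -/
theorem wtopAltM_of_wtopRecNonIsoM {p : ℕ} {Q : ℕ → (ℕ → ℕ) → ∀ X : Scheme.{u}, X → Prop} (h : WtopRecNonIsoM.{u} p Q) :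
    WtopAltM.{u} p Q :=
  fun R hRf hRa ν X _ x hX hQ => noMovingAlternatingNearChainFrom_of_recurrent_not (h R hRf hRa ν X x hX hQ)

/-! ## §3. The registered W-top stubs by the trichotomy; the pointed stub's CLOSER SHAPE OF RECORD -/

/-- **The pointed stub `stub_Wtop3M_pointed` by the trichotomy (proved):** Ev-Iso at every origin predicate (in practice from the isolated
kernel, `wtopEvIsoM_of_towers`), Ev-NonIso at pointed origins (card H product / D1 / D6 / D13) and ALT at pointed origins (D17). [folklore] -/
theorem wtop3PointedM_of_trichotomy {p : ℕ} (hev : ∀ Q, WtopEvIsoM.{u} p Q) (hnon : WtopEvNonIsoM.{u} p QPointed)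
    (halt : WtopAltM.{u} p QPointed) : Wtop3PointedM.{u} p :=
  atQ_of_trichotomy (hev QPointed) hnon halt

/-- **THE POINTED STUB'S CLOSER SHAPE OF RECORD (RULINGS v3.12-4 (V), CRUX-PLAN v3.8):** `Wtop3PointedM p` from the isolated KERNEL
`IsoQuadraticTowerTerminates p 3` (C4/C5), the Ev-NonIso row at pointed origins, and ALT at pointed origins — the isolated-tail extraction being
DISCHARGED (res-D-pv-042 `isoTailTowerExtractionM_holds`, D7, by name through r4's `wtopEvIsoM_of_towers`). [folklore] -/
theorem wtop3PointedM_of_kernel {p : ℕ} (hT : IsoQuadraticTowerTerminates.{u} p 3) (hev : WtopEvNonIsoM.{u} p QPointed)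
    (halt : WtopAltM.{u} p QPointed) : Wtop3PointedM.{u} p :=
  wtop3PointedM_of_trichotomy (wtopEvIsoM_of_towers hT (isoTailTowerExtractionM_holds p)) hev halt

end Summit.ResolutionOfSingularities.ResolutionOfSingularities.Cruxes.SigmaMaxModifications.IdeasL1Idea2R4
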